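import Summits.CriticalPhenomena.PercolationContinuityZ3.Theorems.PercNearOneGluingNoHeavyLowerTailRootedExchange
import HarnessLib

/-!
# `NoHeavyLowerTail` (stmt-CriticalPhenomena-4575) — the rooted two-sided kernel under SEQUENTIAL DOMINATION:
# (DC) with the glued champion as witness, by peeling the other star one pair at a time

Support file (prover `prim-hp-3`, hull-port line; `--supports stmt-CriticalPhenomena-4575`).  No definitions, no named facts, no sorries.

Notation: `μ_w = prodBernoulli w` on `Fin n`, relays `A`, level `j`, `I_w(x) = μ_w{|π(x)| ≤ j}`, E-mass `E_w(v)` of the observer set `O = {o, o'}`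
(`μ_w(v ↮ O, 1 ≤ |π(O)| ≤ j) + μ_w(v ↔ O, |π(v)| ≤ j)`).  Throughout `o` is GLUED to a relay `t` (`w s(o,t) = 1`) and `o' ∉ A` is a pendant star.

* `HullPort.obsE_le_of_glued_isolated` — if `o'` has no positive pair, `E_w(v) ≤ I_w(t)` for every `v ≠ o'`.
* `HullPort.obsE_le_of_glued_both` — if also `w s(o',t) = 1`, `E_w(v) ≤ I_w(t)` for every `v`.
* `HullPort.obsE_le_of_glued_seqDom` — **rooted (DC) under sequential domination.**  List the positive-weight neighbours of `o'` as `p₀, p₁, …`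
  (a list `L ⊆ A` containing them) and let `W 0 = w`, `W (l+1) = (W l)[s(o', p_l) ↦ 0]`.  If `I_{W l}(p_l) ≤ I_{W l}(t)` for every `l` (the glued
  champion still dominates the `l`-th port after the earlier ports are detached), then `E_w(v) ≤ I_w(t)` for every relay `v`.  Proof: one-bond
  decomposition at `s(o', p₀)` with the common witness `t` (`obsE_le_of_common_witness`): the glued face is `obsE_le_of_doublyGlued` (domination
  transported by `lightness_le_of_raise_own_edge`) or `obsE_le_of_glued_both` when `p₀ = t`; the deleted face is the induction hypothesis.
* `HullPort.obsE_le_champion_of_seqDom` — **the champion-edge step with a rooted glued face**: for a port `t` of `o` with `w s(o,t) < 1` dominating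
  `q` in `w`, (DC) for `v` one pair down with witness `q`, and sequential domination at the glued face `w[s(o,t) ↦ 1]`, `E_w(v) ≤ I_w(t)`
  (`obsE_le_champion_of_glued_le` + `obsE_le_of_glued_seqDom`).
WHY (crux notes `HULLPORT-REF-gen6.md` §16): in the (DC) induction for two pendant stars (`dc_of_outsiderStepAll`) this settles the outsider step
(i) at every instance whose lightest port is glued and dominates the other star sequentially (the glued-champion residual), and (ii) along the
champion's fractional pair whenever the glued champion dominates the other star sequentially at the glued face; with IH-persistence and the heavy
step the seat census leaves 13/110 jointcov-hard and 0/1 487 random/hub outsider pairs uncovered.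
-/

noncomputable section

namespace Summit.CriticalPhenomena.PercolationContinuityZ3.Theorems

open MeasureTheory Set Literature.Probability.LatticeModels Literature.Probability.Percolation
open scoped Classical BigOperators

variable {n : ℕ}

namespace HullPort

/-- **Glued observer, isolated second observer.**  `o ≠ t`, `w s(o,t) = 1`, every pair at `o'` has weight `0`, `v ≠ o'`: for `O = {o, o'}`,
`E_w(v) ≤ I_w(t)`. [folklore] -/
theorem obsE_le_of_glued_isolated (w : Sym2 (Fin n) → unitInterval) (A : Finset (Fin n)) (o o' t v : Fin n) (j : ℕ)
    (hot : o ≠ t) (hwt : w s(o, t) = 1) (hiso : ∀ u, w s(o', u) = 0) (hvo' : v ≠ o') :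
    (prodBernoulli w).real {ω : BondConfig (Fin n) | (∀ x ∈ ({o, o'} : Finset (Fin n)), ω ∉ openConn v x) ∧
        1 ≤ (A.filter fun z => ∃ x ∈ ({o, o'} : Finset (Fin n)), ω ∈ openConn x z).card ∧
        (A.filter fun z => ∃ x ∈ ({o, o'} : Finset (Fin n)), ω ∈ openConn x z).card ≤ j} +
      (prodBernoulli w).real {ω : BondConfig (Fin n) | (∃ x ∈ ({o, o'} : Finset (Fin n)), ω ∈ openConn v x) ∧
        (A.filter fun z => ω ∈ openConn v z).card ≤ j} ≤
      (prodBernoulli w).real {ω : BondConfig (Fin n) | (A.filter fun z => ω ∈ openConn t z).card ≤ j} := by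
  set μ := prodBernoulli w with hμ
  set O : Finset (Fin n) := {o, o'} with hO
  set X₁ := {ω : BondConfig (Fin n) | (∀ x ∈ O, ω ∉ openConn v x) ∧
        1 ≤ (A.filter fun z => ∃ x ∈ O, ω ∈ openConn x z).card ∧
        (A.filter fun z => ∃ x ∈ O, ω ∈ openConn x z).card ≤ j} with hX₁
  set X₂ := {ω : BondConfig (Fin n) | (∃ x ∈ O, ω ∈ openConn v x) ∧ (A.filter fun z => ω ∈ openConn v z).card ≤ j} with hX₂
  set Rt := {ω : BondConfig (Fin n) | (A.filter fun z => ω ∈ openConn t z).card ≤ j} with hRt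
  set G : Set (BondConfig (Fin n)) := {ω | s(o, t) ∈ ω} ∩ {ω | ∀ e ∈ ω, w e ≠ 0} with hG
  have hmeas : ∀ S : Set (BondConfig (Fin n)), MeasurableSet S := fun S => (Set.toFinite S).measurableSet
  -- the good set has full measure
  have hfull : ∀ S : Set (BondConfig (Fin n)), μ.real S ≤ μ.real (S ∩ G) := by
    intro S
    have h1 : μ.real (S ∩ {ω : BondConfig (Fin n) | ∀ e ∈ ω, w e ≠ 0}) = μ.real S := CutObserver.measureReal_inter_support w S
    have h2 := edgeSw_real_eq_of_sure w s(o, t) hwt (S ∩ {ω : BondConfig (Fin n) | ∀ e ∈ ω, w e ≠ 0}) (S ∩ G)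
      (fun ω he => by
        simp only [hG, mem_inter_iff, mem_setOf_eq]
        exact ⟨fun h => ⟨h.1, he, h.2⟩, fun h => ⟨h.1, h.2.2⟩⟩)
    rw [← h1, h2]
  -- on the good set: `o ↔ t` and `o'` reaches only itself
  have hreach_ot : ∀ ω ∈ G, (openGraph ω).Reachable o t := by
    intro ω hω
    exact ((openGraph_adj ω o t).mpr ⟨hω.1, hot⟩).reachable
  have hiso' : ∀ ω ∈ G, ∀ z, (openGraph ω).Reachable o' z → z = o' := by
    intro ω hω z hz
    by_contra hne
    -- a walk from `o'` to `z ≠ o'` starts with an open pair at `o'`, which has weight 0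
    obtain ⟨wk⟩ := hz
    cases wk with
    | nil => exact hne rfl
    | @cons _ u _ hadj _ =>
      have h' := (openGraph_adj ω o' u).mp hadj
      exact hω.2 _ h'.1 (hiso u)
  have hX1 : X₁ ∩ G ⊆ Rt ∩ X₁ := by
    rintro ω ⟨hω, hg⟩
    refine ⟨?_, hω⟩
    simp only [hRt, mem_setOf_eq]
    obtain ⟨-, -, hle'⟩ := hω
    refine le_trans (Finset.card_le_card ?_) hle'
    intro z hz
    rw [Finset.mem_filter] at hz ⊢
    refine ⟨hz.1, o, by simp [hO], ?_⟩
    exact ((hreach_ot ω hg).trans (show (openGraph ω).Reachable t z from hz.2) : (openGraph ω).Reachable o z)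
  have hX2 : X₂ ∩ G ⊆ Rt := by
    rintro ω ⟨⟨⟨x, hxO, hvx⟩, hLv⟩, hg⟩
    have hvx' : (openGraph ω).Reachable v x := hvx
    have hvt : (openGraph ω).Reachable v t := by
      simp only [hO, Finset.mem_insert, Finset.mem_singleton] at hxO
      rcases hxO with rfl | rfl
      · exact hvx'.trans (hreach_ot ω hg)
      · exact absurd (hiso' ω hg v hvx'.symm) hvo'
    simp only [hRt, mem_setOf_eq]
    rw [← filter_openConn_eq_of_reachable A hvt]
    exact hLv
  have hX12 : Disjoint (Rt ∩ X₁) (X₂ ∩ G) := by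
    rw [Set.disjoint_left]
    rintro ω ⟨-, ⟨hnot, -⟩⟩ ⟨⟨⟨x, hx, hvx⟩, -⟩, -⟩
    exact hnot x hx hvx
  have hU : μ.real (Rt ∩ X₁ ∪ X₂ ∩ G) = μ.real (Rt ∩ X₁) + μ.real (X₂ ∩ G) := measureReal_union hX12 (hmeas _)
  have hsub : Rt ∩ X₁ ∪ X₂ ∩ G ⊆ Rt := by
    rintro ω (⟨h, -⟩ | h)
    · exact h
    · exact hX2 h
  have h : μ.real (Rt ∩ X₁ ∪ X₂ ∩ G) ≤ μ.real Rt := measureReal_mono hsub (measure_ne_top _ _)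
  have hE1' : μ.real (X₁ ∩ G) ≤ μ.real (Rt ∩ X₁) := measureReal_mono hX1 (measure_ne_top _ _)
  have hE1 := (hfull X₁).trans hE1'
  have hE2 := hfull X₂
  linarith

/-- **Both observers glued to the same relay.**  `o ≠ t`, `o' ≠ t`, `w s(o,t) = 1`, `w s(o',t) = 1`: for `O = {o, o'}`, `E_w(v) ≤ I_w(t)` for every `v`.
[folklore] -/
theorem obsE_le_of_glued_both (w : Sym2 (Fin n) → unitInterval) (A : Finset (Fin n)) (o o' t v : Fin n) (j : ℕ)
    (hot : o ≠ t) (ho't : o' ≠ t) (hwt : w s(o, t) = 1) (hwt' : w s(o', t) = 1) :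
    (prodBernoulli w).real {ω : BondConfig (Fin n) | (∀ x ∈ ({o, o'} : Finset (Fin n)), ω ∉ openConn v x) ∧
        1 ≤ (A.filter fun z => ∃ x ∈ ({o, o'} : Finset (Fin n)), ω ∈ openConn x z).card ∧
        (A.filter fun z => ∃ x ∈ ({o, o'} : Finset (Fin n)), ω ∈ openConn x z).card ≤ j} +
      (prodBernoulli w).real {ω : BondConfig (Fin n) | (∃ x ∈ ({o, o'} : Finset (Fin n)), ω ∈ openConn v x) ∧
        (A.filter fun z => ω ∈ openConn v z).card ≤ j} ≤
      (prodBernoulli w).real {ω : BondConfig (Fin n) | (A.filter fun z => ω ∈ openConn t z).card ≤ j} := by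
  set μ := prodBernoulli w with hμ
  set O : Finset (Fin n) := {o, o'} with hO
  set X₁ := {ω : BondConfig (Fin n) | (∀ x ∈ O, ω ∉ openConn v x) ∧
        1 ≤ (A.filter fun z => ∃ x ∈ O, ω ∈ openConn x z).card ∧
        (A.filter fun z => ∃ x ∈ O, ω ∈ openConn x z).card ≤ j} with hX₁
  set X₂ := {ω : BondConfig (Fin n) | (∃ x ∈ O, ω ∈ openConn v x) ∧ (A.filter fun z => ω ∈ openConn v z).card ≤ j} with hX₂
  set Rt := {ω : BondConfig (Fin n) | (A.filter fun z => ω ∈ openConn t z).card ≤ j} with hRt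
  set G : Set (BondConfig (Fin n)) := {ω | s(o, t) ∈ ω} ∩ {ω | s(o', t) ∈ ω} with hG
  have hmeas : ∀ S : Set (BondConfig (Fin n)), MeasurableSet S := fun S => (Set.toFinite S).measurableSet
  have hfull : ∀ S : Set (BondConfig (Fin n)), μ.real S ≤ μ.real (S ∩ G) := by
    intro S
    have h1 := edgeSw_real_eq_of_sure w s(o, t) hwt S (S ∩ {ω : BondConfig (Fin n) | s(o, t) ∈ ω})
      (fun ω he => by simp only [mem_inter_iff, mem_setOf_eq]; exact ⟨fun h => ⟨h, he⟩, fun h => h.1⟩)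
    have h2 := edgeSw_real_eq_of_sure w s(o', t) hwt' (S ∩ {ω : BondConfig (Fin n) | s(o, t) ∈ ω}) (S ∩ G)
      (fun ω he => by
        simp only [hG, mem_inter_iff, mem_setOf_eq]
        exact ⟨fun h => ⟨h.1, h.2, he⟩, fun h => ⟨h.1, h.2.1⟩⟩)
    rw [h1, h2]
  have hreach : ∀ ω ∈ G, ∀ x ∈ O, (openGraph ω).Reachable x t := by
    intro ω hω x hx
    simp only [hO, Finset.mem_insert, Finset.mem_singleton] at hx
    rcases hx with rfl | rfl
    · exact ((openGraph_adj ω _ t).mpr ⟨hω.1, hot⟩).reachable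
    · exact ((openGraph_adj ω _ t).mpr ⟨hω.2, ho't⟩).reachable
  have hX1 : X₁ ∩ G ⊆ Rt ∩ X₁ := by
    rintro ω ⟨hω, hg⟩
    refine ⟨?_, hω⟩
    simp only [hRt, mem_setOf_eq]
    obtain ⟨-, -, hle'⟩ := hω
    refine le_trans (Finset.card_le_card ?_) hle'
    intro z hz
    rw [Finset.mem_filter] at hz ⊢
    refine ⟨hz.1, o, by simp [hO], ?_⟩
    exact ((hreach ω hg o (by simp [hO])).trans (show (openGraph ω).Reachable t z from hz.2) : (openGraph ω).Reachable o z)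
  have hX2 : X₂ ∩ G ⊆ Rt := by
    rintro ω ⟨⟨⟨x, hxO, hvx⟩, hLv⟩, hg⟩
    have hvt : (openGraph ω).Reachable v t := (show (openGraph ω).Reachable v x from hvx).trans (hreach ω hg x hxO)
    simp only [hRt, mem_setOf_eq]
    rw [← filter_openConn_eq_of_reachable A hvt]
    exact hLv
  have hX12 : Disjoint (Rt ∩ X₁) (X₂ ∩ G) := by
    rw [Set.disjoint_left]
    rintro ω ⟨-, ⟨hnot, -⟩⟩ ⟨⟨⟨x, hx, hvx⟩, -⟩, -⟩
    exact hnot x hx hvx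
  have hU : μ.real (Rt ∩ X₁ ∪ X₂ ∩ G) = μ.real (Rt ∩ X₁) + μ.real (X₂ ∩ G) := measureReal_union hX12 (hmeas _)
  have hsub : Rt ∩ X₁ ∪ X₂ ∩ G ⊆ Rt := by
    rintro ω (⟨h, -⟩ | h)
    · exact h
    · exact hX2 h
  have h : μ.real (Rt ∩ X₁ ∪ X₂ ∩ G) ≤ μ.real Rt := measureReal_mono hsub (measure_ne_top _ _)
  have hE1' : μ.real (X₁ ∩ G) ≤ μ.real (Rt ∩ X₁) := measureReal_mono hX1 (measure_ne_top _ _)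
  have hE1 := (hfull X₁).trans hE1'
  have hE2 := hfull X₂
  linarith

/-- **Rooted (DC) under sequential domination.**  `o, o' ∉ A`, `o ≠ o'`, `t ∈ A`, `w s(o,t) = 1`; `L ⊆ A` a list containing every positive-weight
neighbour of `o'`; `W 0 = w`, `W (l+1) = (W l)[s(o', L[l]) ↦ 0]`; and `I_{W l}(L[l]) ≤ I_{W l}(t)` for all `l < |L|`.  Then `E_w(v) ≤ I_w(t)` for every
`v ∈ A` (observer set `{o, o'}`).  [cite: VandenbergHaggstromKahn2005, Thm. 1.5 (p. 7) — via `obsE_le_of_doublyGlued`; this work] -/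
theorem obsE_le_of_glued_seqDom (A : Finset (Fin n)) (o o' t : Fin n) (j : ℕ)
    (hoA : o ∉ A) (ho'A : o' ∉ A) (hoo' : o ≠ o') (htA : t ∈ A) :
    ∀ (L : List (Fin n)) (w : Sym2 (Fin n) → unitInterval) (W : ℕ → (Sym2 (Fin n) → unitInterval)),
      w s(o, t) = 1 → (∀ u, w s(o', u) ≠ 0 → u ∈ L) → (∀ u ∈ L, u ∈ A) →
      W 0 = w → (∀ l, l < L.length → ∀ (hl : l < L.length), W (l + 1) = Function.update (W l) s(o', L[l]) 0) →
      (∀ l, ∀ (hl : l < L.length),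
        (prodBernoulli (W l)).real {ω : BondConfig (Fin n) | (A.filter fun z => ω ∈ openConn L[l] z).card ≤ j} ≤
          (prodBernoulli (W l)).real {ω : BondConfig (Fin n) | (A.filter fun z => ω ∈ openConn t z).card ≤ j}) →
      ∀ v ∈ A,
        (prodBernoulli w).real {ω : BondConfig (Fin n) | (∀ x ∈ ({o, o'} : Finset (Fin n)), ω ∉ openConn v x) ∧
            1 ≤ (A.filter fun z => ∃ x ∈ ({o, o'} : Finset (Fin n)), ω ∈ openConn x z).card ∧
            (A.filter fun z => ∃ x ∈ ({o, o'} : Finset (Fin n)), ω ∈ openConn x z).card ≤ j} +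
          (prodBernoulli w).real {ω : BondConfig (Fin n) | (∃ x ∈ ({o, o'} : Finset (Fin n)), ω ∈ openConn v x) ∧
            (A.filter fun z => ω ∈ openConn v z).card ≤ j} ≤
        (prodBernoulli w).real {ω : BondConfig (Fin n) | (A.filter fun z => ω ∈ openConn t z).card ≤ j} := by
  have hot : o ≠ t := fun h => hoA (h ▸ htA)
  have ho't : o' ≠ t := fun h => ho'A (h ▸ htA)
  intro L
  induction L with
  | nil =>
    intro w W hwt hcover _ _ _ _ v hvA
    have hiso : ∀ u, w s(o', u) = 0 := by
      intro u
      by_contra h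
      exact (List.not_mem_nil (hcover u h))
    have hvo' : v ≠ o' := fun h => ho'A (h ▸ hvA)
    exact obsE_le_of_glued_isolated w A o o' t v j hot hwt hiso hvo'
  | cons p L' ih =>
    intro w W hwt hcover hLA hW0 hWs hdom v hvA
    have hpA : p ∈ A := hLA p (by simp)
    have hpo' : p ≠ o' := fun h => ho'A (h ▸ hpA)
    have hop : o ≠ p := fun h => hoA (h ▸ hpA)
    -- the pair to peel
    set e : Sym2 (Fin n) := s(o', p) with he
    have hne : s(o, t) ≠ e := by
      rw [he, Ne, Sym2.eq_iff]
      push Not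
      exact ⟨fun h => absurd h hoo', fun h => absurd h hop⟩
    set w₀ := Function.update w e 0 with hw₀
    set w₁ := Function.update w e 1 with hw₁
    have hw₀t : w₀ s(o, t) = 1 := by rw [hw₀, Function.update_of_ne hne]; exact hwt
    have hw₁t : w₁ s(o, t) = 1 := by rw [hw₁, Function.update_of_ne hne]; exact hwt
    -- domination at `w` (l = 0)
    have hdom0 := hdom 0 (by simp)
    simp only [List.getElem_cons_zero] at hdom0
    rw [hW0] at hdom0
    -- glued face
    have h1 : (prodBernoulli w₁).real {ω : BondConfig (Fin n) | (∀ x ∈ ({o, o'} : Finset (Fin n)), ω ∉ openConn v x) ∧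
            1 ≤ (A.filter fun z => ∃ x ∈ ({o, o'} : Finset (Fin n)), ω ∈ openConn x z).card ∧
            (A.filter fun z => ∃ x ∈ ({o, o'} : Finset (Fin n)), ω ∈ openConn x z).card ≤ j} +
          (prodBernoulli w₁).real {ω : BondConfig (Fin n) | (∃ x ∈ ({o, o'} : Finset (Fin n)), ω ∈ openConn v x) ∧
            (A.filter fun z => ω ∈ openConn v z).card ≤ j} ≤
        (prodBernoulli w₁).real {ω : BondConfig (Fin n) | (A.filter fun z => ω ∈ openConn t z).card ≤ j} := by
      by_cases hpt : p = t
      · have hw₁' : w₁ s(o', t) = 1 := by rw [hw₁, he, hpt]; simp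
        exact obsE_le_of_glued_both w₁ A o o' t v j hot ho't hw₁t hw₁'
      · have hw₁p : w₁ s(o', p) = 1 := by rw [hw₁, he]; simp
        -- domination survives raising the pair at the loser `p`
        have hraise : (prodBernoulli w₁).real {ω : BondConfig (Fin n) | (A.filter fun z => ω ∈ openConn p z).card ≤ j} ≤
            (prodBernoulli w₁).real {ω : BondConfig (Fin n) | (A.filter fun z => ω ∈ openConn t z).card ≤ j} := by
          have hpo'e : s(p, o') = e := by rw [he, Sym2.eq_swap]
          have hw_eq : Function.update w s(p, o') (w s(p, o')) = w := Function.update_eq_self _ _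
          have h := lightness_le_of_raise_own_edge w A p o' t j hpo' (fun h => hpt h.symm) (w s(p, o')) 1
            (by exact_mod_cast (w s(p, o')).2.2) (by rw [hw_eq]; exact hdom0)
          rw [hpo'e] at h
          exact h
        exact obsE_le_of_doublyGlued w₁ A o o' p t v j hot (Ne.symm hpo') hpt hw₁t hw₁p hraise
    -- deleted face: induction hypothesis with the shifted weights
    have h0 : (prodBernoulli w₀).real {ω : BondConfig (Fin n) | (∀ x ∈ ({o, o'} : Finset (Fin n)), ω ∉ openConn v x) ∧
            1 ≤ (A.filter fun z => ∃ x ∈ ({o, o'} : Finset (Fin n)), ω ∈ openConn x z).card ∧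
            (A.filter fun z => ∃ x ∈ ({o, o'} : Finset (Fin n)), ω ∈ openConn x z).card ≤ j} +
          (prodBernoulli w₀).real {ω : BondConfig (Fin n) | (∃ x ∈ ({o, o'} : Finset (Fin n)), ω ∈ openConn v x) ∧
            (A.filter fun z => ω ∈ openConn v z).card ≤ j} ≤
        (prodBernoulli w₀).real {ω : BondConfig (Fin n) | (A.filter fun z => ω ∈ openConn t z).card ≤ j} := by
      have hW1 : W 1 = w₀ := by
        have h := hWs 0 (by simp) (by simp)
        simp only [List.getElem_cons_zero, zero_add] at h
        rw [h, hW0]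
      refine ih w₀ (fun l => W (l + 1)) hw₀t ?_ (fun u hu => hLA u (List.mem_cons_of_mem p hu)) hW1 ?_ ?_ v hvA
      · intro u hu
        by_cases hup : u = p
        · exact absurd (by rw [hup, hw₀, he]; simp) hu
        · have : w s(o', u) ≠ 0 := by
            have hne' : s(o', u) ≠ e := by
              rw [he, Ne, Sym2.eq_iff]; push Not
              exact ⟨fun _ => hup, fun h => absurd h.symm hpo'⟩
            rwa [hw₀, Function.update_of_ne hne'] at hu
          have hmem := hcover u this
          rcases List.mem_cons.mp hmem with h | h
          · exact absurd h hup
          · exact h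
      · intro l hl hl'
        have h := hWs (l + 1) (by simp; omega) (by simp; omega)
        simp only [List.getElem_cons_succ] at h
        exact h
      · intro l hl
        have h := hdom (l + 1) (by simp; omega)
        simp only [List.getElem_cons_succ] at h
        exact h
    -- common witness `t`
    have hcw := obsE_le_of_common_witness w A ({o, o'} : Finset (Fin n)) e v t j h0 h1
    exact hcw

/-- **The champion-edge step with a rooted glued face.**  `o₁, o₂ ∉ A`, `o₁ ≠ o₂`, a port `t ∈ A` of `o₁` with `w s(o₁,t) < 1` dominating `q` in `w`
(`I_w(q) ≤ I_w(t)`), (DC) for `v` one pair down with witness `q` (`E_{w[s(t,o₁)↦0]}(v) ≤ I(q)` there), and sequential domination of `o₂`'s ports by `t`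
at the glued face `w[s(t,o₁)↦1]` (list `L`, weights `W`).  Then `E_w(v) ≤ I_w(t)`.
[cite: VandenbergHaggstromKahn2005, Thm. 1.5 (p. 7) — via `obsE_le_champion_of_glued_le` and `obsE_le_of_glued_seqDom`; this work] -/
theorem obsE_le_champion_of_seqDom (w : Sym2 (Fin n) → unitInterval) (A : Finset (Fin n)) (o₁ o₂ t v q : Fin n) (j : ℕ)
    (ho₁A : o₁ ∉ A) (ho₂A : o₂ ∉ A) (h12 : o₁ ≠ o₂) (htA : t ∈ A) (hvA : v ∈ A) (hlt : (w s(t, o₁) : ℝ) < 1)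
    (hdom : (prodBernoulli w).real {ω : BondConfig (Fin n) | (A.filter fun z => ω ∈ openConn q z).card ≤ j} ≤
      (prodBernoulli w).real {ω : BondConfig (Fin n) | (A.filter fun z => ω ∈ openConn t z).card ≤ j})
    (h0 : (prodBernoulli (Function.update w s(t, o₁) 0)).real {ω : BondConfig (Fin n) | (∀ x ∈ ({o₁, o₂} : Finset (Fin n)), ω ∉ openConn v x) ∧
          1 ≤ (A.filter fun z => ∃ x ∈ ({o₁, o₂} : Finset (Fin n)), ω ∈ openConn x z).card ∧
          (A.filter fun z => ∃ x ∈ ({o₁, o₂} : Finset (Fin n)), ω ∈ openConn x z).card ≤ j} +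
        (prodBernoulli (Function.update w s(t, o₁) 0)).real {ω : BondConfig (Fin n) | (∃ x ∈ ({o₁, o₂} : Finset (Fin n)), ω ∈ openConn v x) ∧
          (A.filter fun z => ω ∈ openConn v z).card ≤ j} ≤
        (prodBernoulli (Function.update w s(t, o₁) 0)).real
          {ω : BondConfig (Fin n) | (A.filter fun z => ω ∈ openConn q z).card ≤ j})
    (L : List (Fin n)) (W : ℕ → (Sym2 (Fin n) → unitInterval))
    (hcover : ∀ u, (Function.update w s(t, o₁) 1) s(o₂, u) ≠ 0 → u ∈ L) (hLA : ∀ u ∈ L, u ∈ A)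
    (hW0 : W 0 = Function.update w s(t, o₁) 1)
    (hWs : ∀ l, l < L.length → ∀ (hl : l < L.length), W (l + 1) = Function.update (W l) s(o₂, L[l]) 0)
    (hseq : ∀ l, ∀ (hl : l < L.length),
        (prodBernoulli (W l)).real {ω : BondConfig (Fin n) | (A.filter fun z => ω ∈ openConn L[l] z).card ≤ j} ≤
          (prodBernoulli (W l)).real {ω : BondConfig (Fin n) | (A.filter fun z => ω ∈ openConn t z).card ≤ j}) :
    (prodBernoulli w).real {ω : BondConfig (Fin n) | (∀ x ∈ ({o₁, o₂} : Finset (Fin n)), ω ∉ openConn v x) ∧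
        1 ≤ (A.filter fun z => ∃ x ∈ ({o₁, o₂} : Finset (Fin n)), ω ∈ openConn x z).card ∧
        (A.filter fun z => ∃ x ∈ ({o₁, o₂} : Finset (Fin n)), ω ∈ openConn x z).card ≤ j} +
      (prodBernoulli w).real {ω : BondConfig (Fin n) | (∃ x ∈ ({o₁, o₂} : Finset (Fin n)), ω ∈ openConn v x) ∧
        (A.filter fun z => ω ∈ openConn v z).card ≤ j} ≤
      (prodBernoulli w).real {ω : BondConfig (Fin n) | (A.filter fun z => ω ∈ openConn t z).card ≤ j} := by
  have hto : t ≠ o₁ := fun h => ho₁A (h ▸ htA)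
  refine obsE_le_champion_of_glued_le w A ({o₁, o₂} : Finset (Fin n)) t o₁ v q j hto hlt hdom h0 ?_
  have hw₁t : (Function.update w s(t, o₁) 1) s(o₁, t) = 1 := by rw [Sym2.eq_swap]; simp
  exact obsE_le_of_glued_seqDom A o₁ o₂ t j ho₁A ho₂A h12 htA L (Function.update w s(t, o₁) 1) W hw₁t hcover hLA hW0 hWs hseq v hvA

end HullPort

end Summit.CriticalPhenomena.PercolationContinuityZ3.Theorems

end
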